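import Summits.ABC.IUTFork.Joshi.ATS4DescentSpine
import Summits.ABC.IUTFork.Joshi.ATS4DescentToFirstMainBound
import Summits.ABC.IUTFork.Joshi.ATS4VojtaBoundedDegreeAbc
import Summits.ABC.IUTFork.Joshi.ATS4Prop621Holds
import HarnessLib

/-!
# [J-IV] (arXiv:2403.10430v2) §6.12 ⟶ §7: the E5 DESCENT SPINE composed END TO END to Thm 7.2.1 / `ABC` as typed —
# E-t31's spine (Thm 6.10.1 ⟹ `C_Θ ≥ −1` ⟹ Thm 6.1.1, first inequality) ∘ T-33's §7 chain (⟹ `Thm611Consumed` ⟹ λ-line ⟹ Thm 7.1.1 reduced ⟹ Thm 7.2.1)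

Proof-only companion (0 defs) of the abc-iut cell, branch E «type Joshi's construction, test vs S» (rung LADDER-ABC:A2.E), seat
abc-iut-E-t33 (gen 2), slot T-33 = [J-IV] §7; merge/bridge per plan/E/ASSIGNMENTS.md §4 (1)/(4) on BUILT parents, every input BY
NAME. SOURCE: K. Joshi, *Construction of Arithmetic Teichmüller Spaces IV*, arXiv:2403.10430v2 (unrefereed; bib `Joshi2024ATS4`),
§6.12 p.72 l.2–31 («Proof of Theorem 6.1.1 … Finally one uses ℓ ≥ 7»), §7.1 p.72 l.62 – p.75 l.26, §7.2 p.75 l.27–30 («From Theorem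
7.1.1 one obtains Theorem 2.10.1. In particular: Theorem 7.2.1. The abc-conjecture … and the arithmetic Szpiro conjecture over ℚ are
true.»); page/line = the cell's render `HOME/lit/renders/Joshi-arxiv-2403.10430/`.

FRAMING (binding): this file COMPOSES implications between statements typed from a third party's unrefereed text. It takes NO side
on [IUTchIII] Cor 3.12 / [IUTchIV] Thm 1.10, on Joshi's claims, or on Mochizuki's report on them, and makes NO abc claim: every
printed assertion below is a HYPOTHESIS by name (E-t31's `LocusVolumeDatum.*` inputs of §6.8–§6.11, E-t30's `MainBoundDatum.*`
inputs of §6.4, E-t4's [J-III] Cor 9.11.1.1 at `φ(y₀)` `ATS3.AdelicLocusDatum.Cor91111`, T-29's «prime of Lemma 5.8.7»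
`IsLem587Prime`); the conclusion `Thm721` / `ABC` is reached ONLY under them. Typed ≠ proved; typed AS A CANDIDATE ≠ endorsed.

WHAT IS HERE (all PROVED, composition only).
1. `thm611Consumed_of_thm611Left` — T-33's bridge `thm611Consumed_of_mainBoundDatum` (p433630) weakened to consume ONLY the first
   inequality of Thm 6.1.1, `(1/6)·log(q) ≤ boundLtpd` (p.58 l.5–16) — which is exactly what E-t31's spine
   `MainBoundGlue.thm611_left_of_inputs` (`Joshi/ATS4DescentToFirstMainBound.lean`) delivers; the second inequality (`L_tpd` vs `L`,
   p.58 l.17–23) is displayed again at p.73 l.13–32 but not used afterwards: (7.1.3)–(7.1.11) run on the `L_tpd` quantities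
   (p.73 l.80–93; p.75 l.18–20 «log-diff(x_λ) = log(𝔡^{L_tpd}) and log-con_D(x_λ) = log(𝔣^{L_tpd})»).
2. Per point `P = x_λ` of `U(ℚ̄)_{≤d}`: the named §6 inputs + the glues ⟹ `Thm611Consumed d P ℓ` — three junction forms:
   `thm611Consumed_of_descentInputs` (E-t31's `LowerBound` as the hypothesis), `thm611Consumed_of_cor91111` (the lower bound supplied
   by E-t4's typing of [J-III] Cor 9.11.1.1 at the Frobenius-shifted datum, `DescentGlue.lowerBound_of_cor91111`, `Joshi/ATS4DescentSpine.lean`),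
   `thm611Consumed_of_locusInputs` (one level lower: E-t4's three [J-III] inputs at `φ(y₀)` — (9.9.4) valuation scaling, Lemma 9.10.7.1
   at the exhibited element, «LogVol ≤ 0» — via `ATS3.AdelicLocusDatum.cor91111_of_inputs`).
3. `thm611OnLambdaLine_of_descentInputs`, `thm721_of_descentInputs`, `abc_of_descentInputs` — THE SPINE END TO END: at every compactly
   bounded `Z` with (5.6.2) and every `d ≥ 1`, off an exceptional set of bounded height (Thm 5.7.1, p.73 l.9–13), glued §6 data at a
   prime of Lemma 5.8.7 satisfying the named inputs ⟹ `Thm611OnLambdaLine Z d` (T-33) ⟹ `Thm721` ⟹ `ABC` (T-24's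
   `abcConjecture_iff_ABC`). The list of binders IS the list of printed places carrying Joshi's descent from [J-III] Cor 9.11.1.1 to
   abc; none is discharged here (the classical ones — Prop 5.6.1 = [IUTchIV] Cor 2.2 (i), Lemma 5.8.7 (3), `η_prm = 60` — are already
   tree theorems consumed inside the T-33 / T-29 / T-30 files).
4. Joshi's OWN §6.1 route (Rmk 6.1.2 «the same as [IUTchIV, Thm 1.10] with η_prm = 60», p.58 l.24–27), now that E-t30's
   `MainBoundDatum.thm611_of_theorem110'` (p434248; `η_prm = 60` DISCHARGED by the tree's `isEtaPrm_sixty`) is in the tree: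
   [IUTchIV] Thm 1.10 proof data + the HYPOTHESIS `Cor312` (the real-number content of [IUTchIII] Cor 3.12 for the datum — NOT asserted)
   + `ℓ ≠ 5` at every λ-line point ⟹ `Thm721` (`thm611Consumed_of_thm110ProofData`, `thm721_of_thm110ProofData`). Compare T-33's
   `thm721_of_thm110Legendre` (p433630: the tree's Cor 2.2 ⟹ Cor 2.3 route from the interface `Cor22.Thm110Legendre`): same typed
   endpoint, Joshi's route instead of Mochizuki's.
RELATION TO OUR `Statement` (recorded, not imported — R14: no `Cor312*`/`Thm311*`/`Test*` import here): the spine's one load-bearing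
disputed input, Cor 9.11.1.1 at `φ(y₀)`, is OUR `Cor312.Setting.Statement` transported to `φ(y₀)` given the volume dictionary
(X-03 `Joshi.statement_iff_cor91111` p428664; X-13 `lowerFromCor312_iff_statement`, E-t59/E-t4). Shape (E-PLAN R2/R9): volume-shaped,
S-bypassed; no TEST line. [claim: Joshi2024ATS4, status: disputed]; [claim: Joshi2024ATS3, status: disputed].
-/

noncomputable section

namespace Summit.ABC.IUTFork.Joshi.ATS4

open Literature.NumberTheory.DiophantineGeometry Literature.NumberTheory.DiophantineGeometry.GenEll
open Literature.NumberTheory.EllipticCurves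
open Literature.IUT.LogVolume Literature.IUT.LogVolume.Cor22

/-! ## 1. T-33's bridge, weakened to the first inequality of Thm 6.1.1 -/

/-- **Thm 6.1.1's FIRST inequality alone gives §7.1's consumed form** (p.58 l.5–16 ⟹ p.73 l.13–35 with `d_mod ↦ d`, `e*_mod ↦ δ`):
for T-30's datum `𝔐` glued to the point `P` (`log(q) = Cor22.logQAvoid P {2, ℓ}`, `log(𝔡^{L_tpd}) + log(𝔣^{L_tpd}) = logDiff + logCond`,
`d_mod ≤ d`), `(1/6)·log(q) ≤ boundLtpd` ⟹ `Thm611Consumed d P ℓ`. Same arithmetic as `thm611Consumed_of_mainBoundDatum` (p433630),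
which asked for the whole conjunction `𝔐.Thm611` but used only its first component. PROVED. [folklore] -/
theorem thm611Consumed_of_thm611Left (𝔐 : MainBoundDatum) (h : 1 / 6 * 𝔐.logq ≤ 𝔐.boundLtpd) {d : ℕ} (hdmod : 𝔐.dmod ≤ d)
    (P : NFPoint) (hq : 𝔐.logq = logQAvoid P {2, 𝔐.ell})
    (hLD : 𝔐.logDiffLtpd + 𝔐.logCondLtpd = P.logDiff + P.logCond) : Thm611Consumed d P 𝔐.ell := by
  unfold MainBoundDatum.boundLtpd MainBoundDatum.coeff at h
  unfold Thm611Consumed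
  rw [← hq, ← hLD]
  have hℓ : (0 : ℝ) < 𝔐.ell := by exact_mod_cast 𝔐.ell_prime.pos
  have hd' : (𝔐.dmod : ℝ) ≤ d := by exact_mod_cast hdmod
  have he : (𝔐.emod : ℝ) ≤ 𝔐.dmod := by exact_mod_cast 𝔐.emod_le_dmod
  have hLD0 : 0 ≤ 𝔐.logDiffLtpd + 𝔐.logCondLtpd := add_nonneg 𝔐.logDiffLtpd_nonneg 𝔐.logCondLtpd_nonneg
  have hes : (𝔐.estar : ℝ) ≤ delta d := by
    unfold MainBoundDatum.estar delta; push_cast; nlinarith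
  have hc : 20 * (𝔐.dmod : ℝ) / 𝔐.ell ≤ 20 * (d : ℝ) / 𝔐.ell :=
    div_le_div_of_nonneg_right (by linarith) hℓ.le
  have h2 := mul_le_mul_of_nonneg_right hc hLD0
  have h3 := mul_le_mul_of_nonneg_right hes hℓ.le
  nlinarith [h, h2, h3]

/-! ## 2. Per point: E-t31's spine / E-t4's junction ⟹ `Thm611Consumed` -/

section PerPoint

variable {M : MainBoundDatum} {dd : LocusVolumeDatum} (G : MainBoundGlue M dd)
include G

/-- **Per point, E-t31's spine into §7** (§6.12 p.72 l.2–31 then p.73 l.13–35): the §6.4 inputs on T-30's carrier (Lemma 6.4.1,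
Thm 4.6.1 (5) for `L′/L`, `[L′ : L] ≤ ℓ⁴`), the §6.8–§6.11 inputs on E-t31's carrier ((6.11.1), Prop 6.10.9 on `V^dst_ℚ`, the component
sums, (6.8.11), Lemma 6.7.8, the LOWER BOUND = [J-III] Cor 9.11.1.1 at `φ(y₀)`, the two Frobenius-shift equalities, «(1/2ℓ) log q =
|log q_ℓ|»), the glue, `ℓ ≥ 7`, and the identifications with the point ⟹ `Thm611Consumed d P ℓ`. PROVED (composition:
`MainBoundGlue.thm611_left_of_inputs` ∘ `thm611Consumed_of_thm611Left`). [claim: Joshi2024ATS4, status: disputed] -/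
theorem thm611Consumed_of_descentInputs (h7 : 7 ≤ M.ell) (m₁ : M.Lem641) (m₂ : M.WildBoundLp) (m₃ : M.DegLpLBound)
    (h₁ : dd.Eq6111) (h₂ : ∀ p ∈ dd.Vdst, dd.Prop6109 p) (h₃ : dd.ComponentSums) (h₅ : dd.Eq6811) (h₆ : dd.Lem678)
    (h₇ : dd.LowerBound) (h₈ : dd.FrobShiftQ) (h₉ : dd.FrobShiftVol) (hD : dd.LogqDictionary)
    {d : ℕ} (hdmod : M.dmod ≤ d) (P : NFPoint) (hq : M.logq = logQAvoid P {2, M.ell})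
    (hLD : M.logDiffLtpd + M.logCondLtpd = P.logDiff + P.logCond) : Thm611Consumed d P M.ell :=
  thm611Consumed_of_thm611Left M (G.thm611_left_of_inputs h7 m₁ m₂ m₃ h₁ h₂ h₃ h₅ h₆ h₇ h₈ h₉ hD) hdmod P hq hLD

variable {lstar : ℕ} {W : Type} [Fintype W] {D : SecondMainBoundDatum lstar W} (G' : DescentGlue D dd)
include G'

/-- **Per point, with the lower bound supplied by E-t4's typing of [J-III] Cor 9.11.1.1 at `φ(y₀)`** (`D.shift.Cor91111`, p428048;
`DescentGlue.lowerBound_of_cor91111`, p.66 l.41–43 / p.67 l.37–40): the remaining named inputs + both glues ⟹ `Thm611Consumed d P ℓ`.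
PROVED (composition). [claim: Joshi2024ATS4, status: disputed] -/
theorem thm611Consumed_of_cor91111 (hc : D.shift.Cor91111) (h7 : 7 ≤ M.ell) (m₁ : M.Lem641) (m₂ : M.WildBoundLp)
    (m₃ : M.DegLpLBound) (h₁ : dd.Eq6111) (h₂ : ∀ p ∈ dd.Vdst, dd.Prop6109 p) (h₃ : dd.ComponentSums) (h₅ : dd.Eq6811)
    (h₆ : dd.Lem678) (h₈ : dd.FrobShiftQ) (h₉ : dd.FrobShiftVol) (hD : dd.LogqDictionary)
    {d : ℕ} (hdmod : M.dmod ≤ d) (P : NFPoint) (hq : M.logq = logQAvoid P {2, M.ell})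
    (hLD : M.logDiffLtpd + M.logCondLtpd = P.logDiff + P.logCond) : Thm611Consumed d P M.ell :=
  thm611Consumed_of_descentInputs G h7 m₁ m₂ m₃ h₁ h₂ h₃ h₅ h₆ (G'.lowerBound_of_cor91111 hc h₈) h₈ h₉ hD hdmod P hq hLD

/-- **Per point, one level lower: from E-t4's three [J-III] inputs at `φ(y₀)`** ((9.9.4) valuation scaling, Lemma 9.10.7.1 at the
exhibited element, «LogVol ≤ 0»; `ATS3.AdelicLocusDatum.cor91111_of_inputs`, p428048) + the remaining named [J-IV] inputs + both glues
⟹ `Thm611Consumed d P ℓ`. PROVED (composition). [claim: Joshi2024ATS4, status: disputed] -/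
theorem thm611Consumed_of_locusInputs (s₁ : D.shift.ValuationScaling) (s₂ : D.shift.HullVolumeLowerBound)
    (s₃ : D.shift.LogVolNonpos) (h7 : 7 ≤ M.ell) (m₁ : M.Lem641) (m₂ : M.WildBoundLp) (m₃ : M.DegLpLBound)
    (h₁ : dd.Eq6111) (h₂ : ∀ p ∈ dd.Vdst, dd.Prop6109 p) (h₃ : dd.ComponentSums) (h₅ : dd.Eq6811) (h₆ : dd.Lem678)
    (h₈ : dd.FrobShiftQ) (h₉ : dd.FrobShiftVol) (hD : dd.LogqDictionary)
    {d : ℕ} (hdmod : M.dmod ≤ d) (P : NFPoint) (hq : M.logq = logQAvoid P {2, M.ell})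
    (hLD : M.logDiffLtpd + M.logCondLtpd = P.logDiff + P.logCond) : Thm611Consumed d P M.ell :=
  thm611Consumed_of_cor91111 G G' (D.shift.cor91111_of_inputs s₁ s₂ s₃) h7 m₁ m₂ m₃ h₁ h₂ h₃ h₅ h₆ h₈ h₉ hD hdmod P hq hLD

end PerPoint

/-! ## 3. The spine END TO END: λ-line ⟹ Thm 7.1.1 (reduced) ⟹ Thm 7.2.1 ⟹ `ABC` -/

/-- **λ-line** (p.73 l.9–13 «Consider an elliptic curve `C_λ` given by Theorem 5.7.1 and let `Exc` be the set constructed in the proof of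
Theorem 5.7.1 … For `C_λ ∉ Exc`, the estimate provided by Theorem 6.1.1 holds»): off an exceptional set of bounded height, at every point a
prime `ℓ` of Lemma 5.8.7 carrying glued §6 data (T-30's `MainBoundDatum`, E-t31's `LocusVolumeDatum`, `MainBoundGlue`) that satisfy the
named inputs of `thm611Consumed_of_descentInputs` ⟹ T-33's residual `Thm611OnLambdaLine Z d`. PROVED (packaging).
[claim: Joshi2024ATS4, status: disputed] -/
theorem thm611OnLambdaLine_of_descentInputs {Z : CBData} {d : ℕ} (Exc : Set NFPoint) (hExc : ∃ H : ℝ, ∀ P ∈ Exc, P.ht ≤ H)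
    (glue : ∀ P ∈ Z.toSet ∩ UPle d, P ∉ Exc → ∃ (M : MainBoundDatum) (dd : LocusVolumeDatum), MainBoundGlue M dd ∧ 7 ≤ M.ell ∧
      (M.Lem641 ∧ M.WildBoundLp ∧ M.DegLpLBound) ∧
      (dd.Eq6111 ∧ (∀ p ∈ dd.Vdst, dd.Prop6109 p) ∧ dd.ComponentSums ∧ dd.Eq6811 ∧ dd.Lem678 ∧ dd.LowerBound ∧
        dd.FrobShiftQ ∧ dd.FrobShiftVol ∧ dd.LogqDictionary) ∧
      (IsLem587Prime d P M.ell ∧ M.dmod ≤ d ∧ M.logq = logQAvoid P {2, M.ell} ∧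
        M.logDiffLtpd + M.logCondLtpd = P.logDiff + P.logCond)) :
    Thm611OnLambdaLine Z d := by
  refine ⟨Exc, hExc, fun P hP hnot => ?_⟩
  obtain ⟨M, dd, G, h7, ⟨m₁, m₂, m₃⟩, ⟨h₁, h₂, h₃, h₅, h₆, h₇, h₈, h₉, hD⟩, ⟨hℓ, hdmod, hq, hLD⟩⟩ := glue P hP hnot
  exact ⟨M.ell, hℓ, thm611Consumed_of_descentInputs G h7 m₁ m₂ m₃ h₁ h₂ h₃ h₅ h₆ h₇ h₈ h₉ hD hdmod P hq hLD⟩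

/-- **THE E5 SPINE END TO END, to Thm 7.2.1 as typed**: if at every compactly bounded `Z` with (5.6.2) (`Cor22.Hypotheses`) and every
`d ≥ 1` the λ-line carries the glued §6 data above, then `Thm721` (abc 2.1.1 ∧ Szpiro 2.2.1, T-24's ℤ-forms). PROVED AS AN IMPLICATION
(`thm721_of_thm611OnLambdaLine` ∘ `thm611OnLambdaLine_of_descentInputs`); the binders are the printed places of Joshi's descent from
[J-III] Cor 9.11.1.1 to abc, none discharged here; NO abc claim. [claim: Joshi2024ATS4, status: disputed] -/
theorem thm721_of_descentInputs
    (h : ∀ Z : CBData, Hypotheses Z → ∀ d : ℕ, 0 < d → ∃ Exc : Set NFPoint, (∃ H : ℝ, ∀ P ∈ Exc, P.ht ≤ H) ∧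
      ∀ P ∈ Z.toSet ∩ UPle d, P ∉ Exc → ∃ (M : MainBoundDatum) (dd : LocusVolumeDatum), MainBoundGlue M dd ∧ 7 ≤ M.ell ∧
        (M.Lem641 ∧ M.WildBoundLp ∧ M.DegLpLBound) ∧
        (dd.Eq6111 ∧ (∀ p ∈ dd.Vdst, dd.Prop6109 p) ∧ dd.ComponentSums ∧ dd.Eq6811 ∧ dd.Lem678 ∧ dd.LowerBound ∧
          dd.FrobShiftQ ∧ dd.FrobShiftVol ∧ dd.LogqDictionary) ∧
        (IsLem587Prime d P M.ell ∧ M.dmod ≤ d ∧ M.logq = logQAvoid P {2, M.ell} ∧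
          M.logDiffLtpd + M.logCondLtpd = P.logDiff + P.logCond)) : Thm721 :=
  thm721_of_thm611OnLambdaLine fun Z hZ d hd => by
    obtain ⟨Exc, hExc, glue⟩ := h Z hZ d hd
    exact thm611OnLambdaLine_of_descentInputs Exc hExc glue

/-- **… and to the summit statement `ABC`** (through `abc_of_thm721` = T-24's `abcConjecture_iff_ABC`). An implication whose antecedent
carries [J-III] Cor 9.11.1.1 at `φ(y₀)` (Joshi's Cor 3.12 analogue) among its named hypotheses; NO abc claim. [claim: Joshi2024ATS4, status: disputed] -/
theorem abc_of_descentInputs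
    (h : ∀ Z : CBData, Hypotheses Z → ∀ d : ℕ, 0 < d → ∃ Exc : Set NFPoint, (∃ H : ℝ, ∀ P ∈ Exc, P.ht ≤ H) ∧
      ∀ P ∈ Z.toSet ∩ UPle d, P ∉ Exc → ∃ (M : MainBoundDatum) (dd : LocusVolumeDatum), MainBoundGlue M dd ∧ 7 ≤ M.ell ∧
        (M.Lem641 ∧ M.WildBoundLp ∧ M.DegLpLBound) ∧
        (dd.Eq6111 ∧ (∀ p ∈ dd.Vdst, dd.Prop6109 p) ∧ dd.ComponentSums ∧ dd.Eq6811 ∧ dd.Lem678 ∧ dd.LowerBound ∧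
          dd.FrobShiftQ ∧ dd.FrobShiftVol ∧ dd.LogqDictionary) ∧
        (IsLem587Prime d P M.ell ∧ M.dmod ≤ d ∧ M.logq = logQAvoid P {2, M.ell} ∧
          M.logDiffLtpd + M.logCondLtpd = P.logDiff + P.logCond)) : ABC :=
  abc_of_thm721 (thm721_of_descentInputs h)

/-! ## 4. Joshi's own §6.1 route (Rmk 6.1.2): [IUTchIV] Thm 1.10 proof data + the Cor 3.12 HYPOTHESIS ⟹ Thm 7.2.1 -/

/-- **Per point, Joshi's §6.1 route** (Rmk 6.1.2 p.58 l.24–27): T-30's datum glued to `P`, Mochizuki's [IUTchIV] Thm 1.10 proof data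
for its numerics (`Thm110Numerics.ProofData`, tree), the HYPOTHESIS `Cor312` (NOT asserted) and `ℓ ≠ 5` ⟹ `Thm611Consumed d P ℓ` —
E-t30's `MainBoundDatum.thm611_of_theorem110'` (p434248, `η_prm = 60` discharged by `isEtaPrm_sixty`) ∘ T-33's
`thm611Consumed_of_mainBoundDatum` (p433630). PROVED (composition). [claim: Joshi2024ATS4, status: disputed] -/
theorem thm611Consumed_of_thm110ProofData (𝔐 : MainBoundDatum) (θ : ℝ) (PD : (𝔐.toThm110 θ).ProofData)
    (hne : 𝔐.ell ≠ 5) (hcor : (𝔐.toThm110 θ).Cor312) {d : ℕ} (hdmod : 𝔐.dmod ≤ d) (P : NFPoint)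
    (hq : 𝔐.logq = logQAvoid P {2, 𝔐.ell}) (hLD : 𝔐.logDiffLtpd + 𝔐.logCondLtpd = P.logDiff + P.logCond) :
    Thm611Consumed d P 𝔐.ell :=
  thm611Consumed_of_mainBoundDatum 𝔐 (𝔐.thm611_of_theorem110' θ PD hne hcor) hdmod P hq hLD

/-- **End to end on Joshi's §6.1 route**: at every `Z`, `d`, off an exceptional set of bounded height, a glued T-30 datum at a prime of
Lemma 5.8.7 with [IUTchIV] Thm 1.10 proof data, `ℓ ≠ 5` and the Cor 3.12 HYPOTHESIS ⟹ `Thm721`. Same typed endpoint as T-33's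
`thm721_of_thm110Legendre` (p433630, the tree's Cor 2.2 ⟹ Cor 2.3 route); this is Joshi's route. An implication; NO abc claim.
[claim: Joshi2024ATS4, status: disputed] -/
theorem thm721_of_thm110ProofData
    (h : ∀ Z : CBData, Hypotheses Z → ∀ d : ℕ, 0 < d → ∃ Exc : Set NFPoint, (∃ H : ℝ, ∀ P ∈ Exc, P.ht ≤ H) ∧
      ∀ P ∈ Z.toSet ∩ UPle d, P ∉ Exc →
        ∃ (𝔐 : MainBoundDatum) (θ : ℝ) (_ : (𝔐.toThm110 θ).ProofData),
          𝔐.ell ≠ 5 ∧ (𝔐.toThm110 θ).Cor312 ∧ 𝔐.dmod ≤ d ∧ IsLem587Prime d P 𝔐.ell ∧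
          𝔐.logq = logQAvoid P {2, 𝔐.ell} ∧ 𝔐.logDiffLtpd + 𝔐.logCondLtpd = P.logDiff + P.logCond) : Thm721 :=
  thm721_of_thm611OnLambdaLine fun Z hZ d hd => by
    obtain ⟨Exc, hExc, glue⟩ := h Z hZ d hd
    refine ⟨Exc, hExc, fun P hP hnot => ?_⟩
    obtain ⟨𝔐, θ, PD, hne, hcor, hdmod, hℓ, hq, hLD⟩ := glue P hP hnot
    exact ⟨𝔐.ell, hℓ, thm611Consumed_of_thm110ProofData 𝔐 θ PD hne hcor hdmod P hq hLD⟩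

end Summit.ABC.IUTFork.Joshi.ATS4

end
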